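import Summits.BirchSwinnertonDyer.BirchSwinnertonDyer.Theorems.CountingDoorF2AtThreeRefinedDoorFamily
import HarnessLib

/-!
# BirchSwinnertonDyer / CountingDoorF2AtThree — the ROOT-NUMBER-FREE TAIL DOOR: the leaf from the
# `3`-Selmer average (I1) and a `3`-Selmer TAIL density `dens{#Sel₃ ≥ 81} > 1/6` (Z), in place of the
# root-number crux I2 `RootNumberPlusLowerDensityLargeF2`

Route `route-BirchSwinnertonDyer-CountingDoorF2AtThree` (cell bsd-rank2; TWIN leaf
`PAdicBSDRankTwoPositiveProportion`, rev 18: `closes hB hIn h1 h2` with I1 `SelmerThreeAverageLargeF2`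
and I2 `RootNumberPlusLowerDensityLargeF2` the two open XL cruxes). Seat bsd-rank2-rootno-p2 GEN 5
(WIDTH-LEVER lane B on crux I2, stmt-BirchSwinnertonDyer-19441).

WHY THIS FILE. The crux I2 («in every large `Φ ⊆ F₂` with nonempty residue sets the root number is
`+1` with lower density `> 1/6`») is equivalent, modulo bookkeeping landed by lane B GEN 0–3
(`CountingDoorF2AtThreeRootNumberBias`, `…ClosedForm`, `…TypeI`, `…SieveTail`), to a `2/3`-BIAS
weak-Chowla bound for the Liouville function of the irreducible weighted-degree-12 discriminant form
`Δ_{F₂}` twisted by an explicit Jacobi symbol — OPEN, with no mechanism in print (crux ideation census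
`Cruxes/RootNumberPlusLowerDensityLargeF2/IDEATION-CENSUS-r1-s1.md`, 14 levers; lane-B census v4). The
same census (§4, recommendation (b)) types ONE door input of a DIFFERENT KIND that the first-moment
door can consume INSTEAD of I2 and that carries no root number, no parity fact and no `L`-function:

  (Z)  `∀ Φ large with nonempty residue sets, ∃ ζ > 1/6, Φ.DensityOnGE (fun a ↦ 81 ≤ #Sel₃(E_a)) ζ`

— «two independent `3`-Selmer classes beyond the marked ones for more than a sixth of the family»
(Poonen–Rains quotient model: `P(dim ≥ 2) = 0.2012 > 1/6`). This file proves the door identity behind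
it and the by-name chains, so that the tenure re-cut «I1 ∧ (I2 ∨ Z) ⇒ leaf» is one `route edit`:

* §1 PARITY-FREE Selmer levels (no Dokchitser–Dokchitser): `rank ≥ 2 ∧ #E(ℚ)[p] = 1 ⟹ p² ≤ #Sel_p`
  (`sq_le_card_selmerGroup_of_rank`), and `… ∧ #Sel_p ≠ p² ⟹ p³ ≤ #Sel_p`
  (`cube_le_card_selmerGroup_of_ne_sq`; `#Sel_p = p^s`, `s ≥ 2`, `s ≠ 2`).
* §2 the TAIL counting inequality on a finite set (`tail_counting_inequality`:
  `c_mid·#B + (c_hi − c_mid)·#(B ∩ T) ≤ c_hi·#(B ∩ G) + ∑_B f` from `f ≥ 0`, `f ≥ c_hi` on `T ∖ G`,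
  `f ≥ c_mid` off `T ∪ G`, `c_mid ≤ c_hi`) and the **tail door at a prime `p`**
  (`densityOnGE_card_selmerGroup_eq_sq_of_cappedAverage_of_tail`,
  `hasPositiveLowerDensityOn_card_selmerGroup_eq_sq_of_cappedAverage_of_tail`): on any `Φ ⊆ F₂` on which
  `rank ≥ 2 ∧ #E(ℚ)[p] = 1` holds for `100 %`, `limsup avg min(#Sel_p, p⁴) ≤ A`,
  `liminf dens{p⁴ ≤ #Sel_p} ≥ ζ > 0` and `A < p³ + (p⁴ − p³)ζ` give `dens{#Sel_p = p²} ≥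
  (p³ + (p⁴ − p³)ζ − A)/p⁴ > 0`. SAME threshold as the root-number door (`A < p³ + (p⁴ − p³)ρ`,
  kernel `hasPositiveLowerDensityOn_card_selmerGroup_eq_sq_of_cappedAverage`), with `ζ` in place of
  `ρ` and NO parity hypothesis `hDD`. At `p = 3`, `A = 36`: `ζ > 1/6`
  (`hasPositiveLowerDensityOn_selmerNine_of_cappedAverage_of_tail`).
* §3 BY NAME: `selmerNineDensity_of_cappedAverage_of_selmerTail` (LargeFamilyInputsF2 → I1cap → Z → D9,
  no parity), `pAdicBSDRankTwoPositiveProportion_of_selmerThreeAverage_of_selmerTail :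
  PublishedInputsAtThree → SelmerThreeAverageLargeF2 → Z → PAdicBSDRankTwoPositiveProportion` (on the
  refined door family of `Theorems.exists_refinedDoorFamily_densities` — `LargeFamilyInputsF2` is NOT a
  hypothesis; only Schneider 1985 / Perrin-Riou, Mazur–Tate `σ` and Skinner–Urban are used from the
  published inputs, the Dokchitser–Dokchitser conjunct is IDLE), the capped form
  `…_of_cappedAverage_of_selmerTail`, and the FACT-FREE weak leaf
  `weakLeaf_of_selmerThreeAverage_of_selmerTail` (I1 → Z → on an explicit large `Φ`, `rank = 2 ∧
  Ш[3^∞] = 0` with positive lower density — no published input whatsoever: no parity, no modularity, no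
  main conjecture, no height).
* §4 the general-`p` threshold (`threshold_iff_inv_lt`: with the Poonen–Rains first moment
  `A = p²(p+1)`, `p²(p+1) < p³ + (p⁴ − p³)ζ ↔ 1/(p(p−1)) < ζ` — the same `1/2, 1/6, 1/20` at
  `p = 2, 3, 5` as the root-number door), an arithmetic identity.

HONESTY. Z is OPEN (no mechanism producing two extra independent `3`-Selmer classes on a positive
proportion of a large subfamily of `F₂` is known; large-Selmer lower bounds are proved only in twist
families) — it REPLACES one open crux by another of a different kind (algebraic/distributional, immune to
the parity wall); it must be taken INSTEAD of I2, never alongside (the two partial densities do not add: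
census B-β). Nothing here proves I1, I2 or Z; nothing reads an analytic rank (B1); no S0 motion; BSD is
not proved by any of this. THEOREMS ONLY: no definition, no named fact beyond explicit hypotheses, no
`sorry`; standard axioms. PARTITION: none — r_an ≥ 2, summit axis S0 (D-0036(1) funded rung); TWIN
(D-0056): n/a.

References: B. Poonen, E. Rains, *Random maximal isotropic subspaces and Selmer groups*, J. AMS 25
(2012) §2 (the model behind `36 = 3²·4` and `P(dim ≥ 2)`) [PoonenRains2012]; M. Bhargava, A. Shankar,
Ann. of Math. 181 (2015) §1 (first-moment method) [BhargavaShankarTernary2015]; M. Bhargava, W. Ho,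
arXiv:2207.03309 (2022) Thm. 1.2, Thm. 10.1 [BhargavaHo2022]; J. H. Silverman, *AEC* (2009) Thm X.4.2
(`#Sel_p = p^s ≥ p^rank·#E(ℚ)[p]`) [SilvermanAEC2009].
-/

set_option linter.dupNamespace false

noncomputable section

open scoped Classical
open Filter Topology Finset
open WeierstrassCurve Literature.NumberTheory.EllipticCurves
  Literature.NumberTheory.EllipticCurves.ModularForms CongruenceSubgroup
  Literature.NumberTheory.EllipticCurves.BhargavaHo2022
  Summit.BirchSwinnertonDyer.Rank2
  Summit.BirchSwinnertonDyer.BirchSwinnertonDyer.Theses.CountingDoorF2AtThree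

namespace Summit.BirchSwinnertonDyer.BirchSwinnertonDyer.Theorems

/-! ### §1 Parity-free Selmer levels -/

section Levels

variable (W : WeierstrassCurve ℚ) [W.IsElliptic] (p : ℕ) [Fact p.Prime]

/-- **`rank ≥ 2` and `#E(ℚ)[p] = 1` give `p² ≤ #Sel_p(E)`** (`p^rank · #E(ℚ)[p] ≤ #Sel_p`, Silverman
X.4.2; no parity). [cite: SilvermanAEC2009, Thm X.4.2] -/
theorem sq_le_card_selmerGroup_of_rank (h2 : 2 ≤ W.mordellWeilRank)
    (ht : Nat.card (AddSubgroup.torsionBy W.toAffine.Point (p : ℤ)) = 1) :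
    p ^ 2 ≤ Nat.card (W.selmerGroup p) := by
  have hp : p.Prime := Fact.out
  have hrk : p ^ W.mordellWeilRank * 1 ≤ Nat.card (W.selmerGroup p) := by
    convert W.pow_mordellWeilRank_mul_card_torsionBy_le_card_selmerGroup hp.ne_zero using 2
    convert ht.symm
  rw [mul_one] at hrk
  exact (pow_le_pow_right₀ hp.one_le h2).trans hrk

/-- **`rank ≥ 2`, `#E(ℚ)[p] = 1` and `#Sel_p(E) ≠ p²` give `p³ ≤ #Sel_p(E)`** — with NO parity input:
`#Sel_p = p^s` (a finite group killed by `p`), `s ≥ 2` by `sq_le_card_selmerGroup_of_rank`, `s ≠ 2`.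
[cite: SilvermanAEC2009, Thm X.4.2] -/
theorem cube_le_card_selmerGroup_of_ne_sq (h2 : 2 ≤ W.mordellWeilRank)
    (ht : Nat.card (AddSubgroup.torsionBy W.toAffine.Point (p : ℤ)) = 1)
    (hne : Nat.card (W.selmerGroup p) ≠ p ^ 2) : p ^ 3 ≤ Nat.card (W.selmerGroup p) := by
  have hp : p.Prime := Fact.out
  obtain ⟨s, hs⟩ := exists_natCard_selmerGroup_eq_pow W p
  have h2s : p ^ 2 ≤ p ^ s := hs ▸ sq_le_card_selmerGroup_of_rank W p h2 ht
  have hs2 : 2 ≤ s := (pow_le_pow_iff_right₀ hp.one_lt).mp h2s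
  have hs2' : s ≠ 2 := fun h ↦ hne (by rw [hs, h])
  have hs3 : 3 ≤ s := by omega
  rw [hs]
  exact pow_le_pow_right₀ hp.one_le hs3

end Levels

/-! ### §2 The tail counting inequality and the tail door at a prime `p` -/

/-- **Tail counting inequality** on a finite set `B`: if `0 ≤ f` on `B`, `c_hi ≤ f` on `(B ∩ T) ∖ G`
and `c_mid ≤ f` on `B ∖ (T ∪ G)`, with `c_mid ≤ c_hi`, then
`c_mid · #B + (c_hi − c_mid) · #(B ∩ T) ≤ c_hi · #(B ∩ G) + ∑_{i ∈ B} f i`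
(minorant `c_mid + (c_hi − c_mid)·[T] − c_hi·[G] ≤ f`). Door instance: `f = min(#Sel_p, p⁴)`,
`T = {p⁴ ≤ #Sel_p}`, `G = {#Sel_p = p²}`, `c_mid = p³`, `c_hi = p⁴` (each enlarged by the density-zero
exceptional set, which is why `G` is excused on `T` too). [folklore] -/
theorem tail_counting_inequality {ι : Type*} (B : Finset ι) (f : ι → ℝ) (T G : ι → Prop)
    [DecidablePred T] [DecidablePred G] {c_mid c_hi : ℝ} (hmid_hi : c_mid ≤ c_hi)
    (h0 : ∀ i ∈ B, 0 ≤ f i) (hT : ∀ i ∈ B, T i → ¬ G i → c_hi ≤ f i)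
    (hmidf : ∀ i ∈ B, ¬ T i → ¬ G i → c_mid ≤ f i) :
    c_mid * B.card + (c_hi - c_mid) * (B.filter T).card
      ≤ c_hi * (B.filter G).card + ∑ i ∈ B, f i := by
  set g : ι → ℝ := fun i ↦
    c_mid + (c_hi - c_mid) * (if T i then 1 else 0) - c_hi * (if G i then 1 else 0) with hg
  have hgf : ∀ i ∈ B, g i ≤ f i := by
    intro i hi
    have hf0 := h0 i hi
    by_cases hTi : T i
    · by_cases hGi : G i
      · simp only [hg, hTi, hGi, if_true, mul_one]
        linarith
      · have := hT i hi hTi hGi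
        simp only [hg, hTi, hGi, if_true, if_false, mul_one, mul_zero, sub_zero]
        linarith
    · by_cases hGi : G i
      · simp only [hg, hTi, hGi, if_true, if_false, mul_one, mul_zero, add_zero]
        linarith
      · have := hmidf i hi hTi hGi
        simp only [hg, hTi, hGi, if_false, mul_zero, add_zero, sub_zero]
        exact this
  have hsum_g : ∑ i ∈ B, g i = c_mid * B.card + (c_hi - c_mid) * (B.filter T).card
      - c_hi * (B.filter G).card := by
    simp only [hg, Finset.sum_sub_distrib, Finset.sum_add_distrib, Finset.sum_const,
      ← Finset.mul_sum, Finset.sum_boole]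
    ring
  have hle : ∑ i ∈ B, g i ≤ ∑ i ∈ B, f i := Finset.sum_le_sum hgf
  linarith

variable (Φ : CongruenceFamily₂)

/-- **The tail door at a prime `p`, density form — NO parity.** Let `Φ ⊆ F₂` be a subfamily on which
`rank ≥ 2 ∧ #E(ℚ)[p] = 1` holds for `100 %`, with capped first moment `limsup avg min(#Sel_p(E_a), p⁴)
≤ A` and TAIL `liminf dens{a : p⁴ ≤ #Sel_p(E_a)} ≥ ζ > 0`. Then the members with `#Sel_p(E_a) = p²` (or
outside the `100 %` set) have lower density `≥ (p³ + (p⁴ − p³)ζ − A)/p⁴`: member-wise on the `100 %`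
set `min(#Sel_p, p⁴) = p⁴` on the tail and `≥ p³` off the tail unless `#Sel_p = p²`
(`cube_le_card_selmerGroup_of_ne_sq`); the density-zero exceptional set is absorbed into `T` and `G`.
Compare the root-number door `hasPositiveLowerDensityOn_card_selmerGroup_eq_sq_of_cappedAverage` (same
threshold, `ρ` and Dokchitser–Dokchitser parity in place of `ζ`).
[cite: BhargavaShankarTernary2015, §1 (first-moment method)] -/
theorem densityOnGE_card_selmerGroup_eq_sq_of_cappedAverage_of_tail (p : ℕ) [Fact p.Prime]
    {A ζ : ℝ}
    (hA : Φ.AverageOnLE (fun a ↦ min (Nat.card (a.curve.selmerGroup p) : ℝ) ((p : ℝ) ^ 4)) A)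
    (hZ : Φ.DensityOnGE (fun a ↦ p ^ 4 ≤ Nat.card (a.curve.selmerGroup p)) ζ) (hζ : 0 < ζ) :
    Φ.DensityOnGE (fun a ↦ Nat.card (a.curve.selmerGroup p) = p ^ 2 ∨
        ¬ (2 ≤ a.curve.mordellWeilRank ∧
          Nat.card (AddSubgroup.torsionBy a.curve.toAffine.Point (p : ℤ)) = 1))
      (((p : ℝ) ^ 3 + ((p : ℝ) ^ 4 - (p : ℝ) ^ 3) * ζ - A) / (p : ℝ) ^ 4) := by
  have hp : p.Prime := Fact.out
  have hp0 : (0 : ℝ) < p := by exact_mod_cast hp.pos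
  have hp1 : (1 : ℝ) ≤ p := by exact_mod_cast hp.one_lt.le
  have hp34 : (p : ℝ) ^ 3 ≤ (p : ℝ) ^ 4 := pow_le_pow_right₀ hp1 (by norm_num)
  have hp04 : (0 : ℝ) < (p : ℝ) ^ 4 := by positivity
  have hB := eventually_card_below_pos_of_densityOnGE Φ hZ hζ
  -- tail `T` and target `G`, each enlarged by the density-zero exceptional set
  exact densityOnGE_of_counting_inequality Φ
    (f := fun a ↦ min (Nat.card (a.curve.selmerGroup p) : ℝ) ((p : ℝ) ^ 4))
    (W := fun a ↦ p ^ 4 ≤ Nat.card (a.curve.selmerGroup p) ∨ ¬ (2 ≤ a.curve.mordellWeilRank ∧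
      Nat.card (AddSubgroup.torsionBy a.curve.toAffine.Point (p : ℤ)) = 1))
    (G := fun a ↦ Nat.card (a.curve.selmerGroup p) = p ^ 2 ∨ ¬ (2 ≤ a.curve.mordellWeilRank ∧
      Nat.card (AddSubgroup.torsionBy a.curve.toAffine.Point (p : ℤ)) = 1))
    (c₀ := (p : ℝ) ^ 3) (c₁ := (p : ℝ) ^ 4 - (p : ℝ) ^ 3) (c₂ := (p : ℝ) ^ 4) (A := A) (ρ := ζ)
    (by linarith) hp04
    (Filter.Eventually.of_forall fun X ↦
      tail_counting_inequality (Φ.below X)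
        (fun a ↦ min (Nat.card (a.curve.selmerGroup p) : ℝ) ((p : ℝ) ^ 4))
        (fun a ↦ p ^ 4 ≤ Nat.card (a.curve.selmerGroup p) ∨ ¬ (2 ≤ a.curve.mordellWeilRank ∧
          Nat.card (AddSubgroup.torsionBy a.curve.toAffine.Point (p : ℤ)) = 1))
        (fun a ↦ Nat.card (a.curve.selmerGroup p) = p ^ 2 ∨ ¬ (2 ≤ a.curve.mordellWeilRank ∧
          Nat.card (AddSubgroup.torsionBy a.curve.toAffine.Point (p : ℤ)) = 1))
        hp34
        (fun a _ ↦ le_min (Nat.cast_nonneg _) hp04.le)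
        (by
          intro a _ hTa hGa
          obtain ⟨-, hgood⟩ := not_or.mp hGa
          have htail := hTa.resolve_right hgood
          exact le_min (by exact_mod_cast htail) le_rfl)
        (by
          intro a ha hTa hGa
          obtain ⟨-, hgood⟩ := not_or.mp hTa
          obtain ⟨hne, -⟩ := not_or.mp hGa
          obtain ⟨hrk, ht⟩ := not_not.mp hgood
          haveI : a.curve.IsElliptic := a.isElliptic_curve ((Φ.mem_below_iff a X).1 ha).1.1
          have h3 := cube_le_card_selmerGroup_of_ne_sq a.curve p hrk ht hne
          exact le_min (by exact_mod_cast h3) hp34))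
    hA (densityOnGE_mono Φ hZ fun a h ↦ Or.inl h) hB

/-- **The tail door at a prime `p`, positive-proportion form — NO parity.** On any `Φ ⊆ F₂` on which
`rank ≥ 2 ∧ #E(ℚ)[p] = 1` holds for `100 %`: a capped average `limsup avg min(#Sel_p, p⁴) ≤ A`, a tail
`liminf dens{p⁴ ≤ #Sel_p} ≥ ζ > 0` and `A < p³ + (p⁴ − p³)ζ` give a POSITIVE LOWER DENSITY of members
with `#Sel_p(E_a) = p²`. [cite: BhargavaShankarTernary2015, §1 (first-moment method)] -/
theorem hasPositiveLowerDensityOn_card_selmerGroup_eq_sq_of_cappedAverage_of_tail (p : ℕ)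
    [Fact p.Prime]
    (hGood : Φ.HasDensityOn (fun a ↦ 2 ≤ a.curve.mordellWeilRank ∧
      Nat.card (AddSubgroup.torsionBy a.curve.toAffine.Point (p : ℤ)) = 1) 1)
    {A ζ : ℝ}
    (hA : Φ.AverageOnLE (fun a ↦ min (Nat.card (a.curve.selmerGroup p) : ℝ) ((p : ℝ) ^ 4)) A)
    (hZ : Φ.DensityOnGE (fun a ↦ p ^ 4 ≤ Nat.card (a.curve.selmerGroup p)) ζ) (hζ : 0 < ζ)
    (hAζ : A < (p : ℝ) ^ 3 + ((p : ℝ) ^ 4 - (p : ℝ) ^ 3) * ζ) :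
    Φ.HasPositiveLowerDensityOn (fun a ↦ Nat.card (a.curve.selmerGroup p) = p ^ 2) := by
  have hp : p.Prime := Fact.out
  have hp0 : (0 : ℝ) < p := by exact_mod_cast hp.pos
  have hp04 : (0 : ℝ) < (p : ℝ) ^ 4 := by positivity
  have key := hasPositiveLowerDensityOn_of_densityOnGE Φ
    (densityOnGE_card_selmerGroup_eq_sq_of_cappedAverage_of_tail Φ p hA hZ hζ)
    (div_pos (by linarith) hp04)
  have key2 := hasPositiveLowerDensityOn_and_of_hasDensityOn_one Φ hGood key
  exact hasPositiveLowerDensityOn_mono Φ key2 fun a h ↦ h.2.resolve_right (not_not.mpr h.1)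

/-- **At `p = 3`**: on any `Φ ⊆ F₂` on which `rank ≥ 2 ∧ #E(ℚ)[3] = 1` holds for `100 %`, a capped
`3`-Selmer average `limsup avg min(#Sel₃(E_a), 81) ≤ A`, a tail `liminf dens{81 ≤ #Sel₃(E_a)} ≥ ζ > 0`
and `A < 27 + 54ζ` give a POSITIVE LOWER DENSITY of members with `#Sel₃(E_a) = 9` — no root number, no
parity. With `A = 36` the threshold is `ζ > 1/6` (the census's I1cap ∧ Z ⇒ D9).
[cite: BhargavaShankarTernary2015, §1 (first-moment method)] -/
theorem hasPositiveLowerDensityOn_selmerNine_of_cappedAverage_of_tail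
    (hGood : Φ.HasDensityOn (fun a ↦ 2 ≤ a.curve.mordellWeilRank ∧
      Nat.card (AddSubgroup.torsionBy a.curve.toAffine.Point (3 : ℤ)) = 1) 1)
    {A ζ : ℝ} (hA : Φ.AverageOnLE (fun a ↦ min (Nat.card (a.curve.selmerGroup 3) : ℝ) 81) A)
    (hZ : Φ.DensityOnGE (fun a ↦ 81 ≤ Nat.card (a.curve.selmerGroup 3)) ζ) (hζ : 0 < ζ)
    (hAζ : A < 27 + 54 * ζ) :
    Φ.HasPositiveLowerDensityOn (fun a ↦ Nat.card (a.curve.selmerGroup 3) = 9) := by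
  have h := hasPositiveLowerDensityOn_card_selmerGroup_eq_sq_of_cappedAverage_of_tail Φ 3
    (by exact_mod_cast hGood) (A := A) (ζ := ζ) (by norm_num; exact hA) (by norm_num; exact hZ) hζ
    (by norm_num; linarith)
  norm_num at h
  exact h

/-! ### §3 The chains BY NAME: I1 (or I1cap) ∧ Z ⇒ D9 ⇒ leaf, with no parity fact -/

/-- **D9 from the capped average and the TAIL density** (modulo the large-family facts only; NO
Dokchitser–Dokchitser parity): if on every large `Φ` the capped `3`-Selmer average is `≤ 36` (I1cap)
and on every large `Φ` with nonempty residue sets `#Sel₃(E_a) ≥ 81` has lower density `ζ > 1/6` (Z),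
then on every large `Φ` with nonempty residue sets the members with `#Sel₃(E_a) = 9` have positive lower
density (D9). Trivial torsion and `rank ≥ 2` for `100 %` come from I0 (`Theorems.genericMembersLargeF2`)
under `LargeFamilyInputsF2`; compare `Theorems.selmerNineDensity_of_cappedAverage` (I1cap ∧ I2 ⇒ D9,
which needs parity). [cite: BhargavaShankarTernary2015, §1 (first-moment method)] -/
theorem selmerNineDensity_of_cappedAverage_of_selmerTail (hLF : LargeFamilyInputsF2)
    (h1 : ∀ Φ : CongruenceFamily₂, Φ.IsLarge →
      Φ.AverageOnLE (fun a ↦ min (Nat.card (a.curve.selmerGroup 3) : ℝ) 81) 36)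
    (hZ : ∀ Φ : CongruenceFamily₂, Φ.IsLarge → (∀ p : ℕ, p.Prime → (Φ.residues p).Nonempty) →
      ∃ ζ : ℝ, 1 / 6 < ζ ∧ Φ.DensityOnGE (fun a ↦ 81 ≤ Nat.card (a.curve.selmerGroup 3)) ζ)
    (Φ : CongruenceFamily₂) (hL : Φ.IsLarge) (hne : ∀ p : ℕ, p.Prime → (Φ.residues p).Nonempty) :
    Φ.HasPositiveLowerDensityOn (fun a ↦ Nat.card (a.curve.selmerGroup 3) = 9) := by
  obtain ⟨ζ, hζ6, hT⟩ := hZ Φ hL hne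
  have hGood := hasDensityOn_rank_torsionBy_of_torsionOrder Φ 3 (genericMembersLargeF2 hLF Φ hL hne)
  exact hasPositiveLowerDensityOn_selmerNine_of_cappedAverage_of_tail Φ hGood (h1 Φ hL) hT
    (by linarith) (by linarith)

/-- **D9 from I1 and Z** (modulo the large-family facts only, no parity): `SelmerThreeAverageLargeF2`
and the tail density Z give, on every large `Φ` with nonempty residue sets, a positive lower density of
members with `#Sel₃(E_a) = 9`. [cite: BhargavaShankarTernary2015, §1 (first-moment method)] -/
theorem selmerNineDensity_of_selmerThreeAverage_of_selmerTail (hLF : LargeFamilyInputsF2)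
    (h1 : SelmerThreeAverageLargeF2)
    (hZ : ∀ Φ : CongruenceFamily₂, Φ.IsLarge → (∀ p : ℕ, p.Prime → (Φ.residues p).Nonempty) →
      ∃ ζ : ℝ, 1 / 6 < ζ ∧ Φ.DensityOnGE (fun a ↦ 81 ≤ Nat.card (a.curve.selmerGroup 3)) ζ)
    (Φ : CongruenceFamily₂) (hL : Φ.IsLarge) (hne : ∀ p : ℕ, p.Prime → (Φ.residues p).Nonempty) :
    Φ.HasPositiveLowerDensityOn (fun a ↦ Nat.card (a.curve.selmerGroup 3) = 9) :=
  selmerNineDensity_of_cappedAverage_of_selmerTail hLF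
    (selmerThreeCappedAverage_of_selmerThreeAverageLargeF2 h1) hZ Φ hL hne

/-- **The leaf from the published inputs at `3`, the CAPPED `3`-Selmer average and the TAIL density Z —
NO root number, NO parity, `LargeFamilyInputsF2` NOT a hypothesis.** On the refined door family of
`Theorems.exists_refinedDoorFamily_densities` (large, nonempty residue sets, member-wise local door
conditions, `torsionOrder = 1 ∧ rank ≥ 2` and Schneider at `3` for `100 %` as THEOREMS) the tail door
(§2) gives the nine-density from I1cap and Z (`36 < 27 + 54ζ` iff `ζ > 1/6`), and
`Theorems.leaf_of_local_selmerNine` closes (only Schneider 1985 / Perrin-Riou, Mazur–Tate `σ` and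
Skinner–Urban are used from `PublishedInputsAtThree`; its Dokchitser–Dokchitser conjunct is idle).
[cite: BhargavaShankarTernary2015, §1 (first-moment method); SkinnerUrban2014, Thm 3.29 (per-member door)] -/
theorem pAdicBSDRankTwoPositiveProportion_of_cappedAverage_of_selmerTail (hIn : PublishedInputsAtThree)
    (h1 : ∀ Φ : CongruenceFamily₂, Φ.IsLarge →
      Φ.AverageOnLE (fun a ↦ min (Nat.card (a.curve.selmerGroup 3) : ℝ) 81) 36)
    (hZ : ∀ Φ : CongruenceFamily₂, Φ.IsLarge → (∀ p : ℕ, p.Prime → (Φ.residues p).Nonempty) →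
      ∃ ζ : ℝ, 1 / 6 < ζ ∧ Φ.DensityOnGE (fun a ↦ 81 ≤ Nat.card (a.curve.selmerGroup 3)) ζ) :
    PAdicBSDRankTwoPositiveProportion := by
  obtain ⟨Φ, hL, hne, hloc, hGen, hSchD⟩ := exists_refinedDoorFamily_densities
  obtain ⟨ζ, hζ6, hT⟩ := hZ Φ hL hne
  have hGood := hasDensityOn_rank_torsionBy_of_torsionOrder Φ 3 hGen
  have hD9 := hasPositiveLowerDensityOn_selmerNine_of_cappedAverage_of_tail Φ hGood (h1 Φ hL) hT
    (by linarith) (by linarith)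
  exact leaf_of_local_selmerNine Φ hL hloc hIn (hasDensityOn_one_mono Φ hGen fun _ h ↦ h.2) hSchD hD9

/-- **The leaf from the published inputs at `3`, I1 and Z** — the statement of the route's `Assembly`
with the root-number crux I2 `RootNumberPlusLowerDensityLargeF2` REPLACED by the tail density Z (and
`LargeFamilyInputsF2` not a hypothesis): the by-name glue for the tenure re-cut «I1 ∧ (I2 ∨ Z) ⇒ leaf»
(its I2 branch is `Theorems.leaf_of_cruxes_without_largeFamilyInputs`).
[cite: BhargavaShankarTernary2015, §1 (first-moment method); SkinnerUrban2014, Thm 3.29 (per-member door)] -/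
theorem pAdicBSDRankTwoPositiveProportion_of_selmerThreeAverage_of_selmerTail
    (hIn : PublishedInputsAtThree) (h1 : SelmerThreeAverageLargeF2)
    (hZ : ∀ Φ : CongruenceFamily₂, Φ.IsLarge → (∀ p : ℕ, p.Prime → (Φ.residues p).Nonempty) →
      ∃ ζ : ℝ, 1 / 6 < ζ ∧ Φ.DensityOnGE (fun a ↦ 81 ≤ Nat.card (a.curve.selmerGroup 3)) ζ) :
    PAdicBSDRankTwoPositiveProportion :=
  pAdicBSDRankTwoPositiveProportion_of_cappedAverage_of_selmerTail hIn
    (selmerThreeCappedAverage_of_selmerThreeAverageLargeF2 h1) hZ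

/-- **Either door input closes the leaf** (the re-cut's glue in one statement): modulo the published
inputs at `3`, I1 together with I2 OR with Z gives `PAdicBSDRankTwoPositiveProportion`.
[cite: BhargavaShankarTernary2015, §1 (first-moment method)] -/
theorem pAdicBSDRankTwoPositiveProportion_of_selmerThreeAverage_of_rootNumber_or_selmerTail
    (hIn : PublishedInputsAtThree) (h1 : SelmerThreeAverageLargeF2)
    (h2Z : RootNumberPlusLowerDensityLargeF2 ∨
      ∀ Φ : CongruenceFamily₂, Φ.IsLarge → (∀ p : ℕ, p.Prime → (Φ.residues p).Nonempty) →
        ∃ ζ : ℝ, 1 / 6 < ζ ∧ Φ.DensityOnGE (fun a ↦ 81 ≤ Nat.card (a.curve.selmerGroup 3)) ζ) :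
    PAdicBSDRankTwoPositiveProportion :=
  h2Z.elim (leaf_of_cruxes_without_largeFamilyInputs hIn h1)
    (pAdicBSDRankTwoPositiveProportion_of_selmerThreeAverage_of_selmerTail hIn h1)

/-- **The tail door gives the WEAK leaf with NO published input at all.** Φ-local, any prime `p`: on a
`Φ ⊆ F₂` on which `rank ≥ 2 ∧ #E(ℚ)[p] = 1` holds for `100 %`, a capped average
`limsup avg min(#Sel_p, p⁴) ≤ A`, a tail `liminf dens{p⁴ ≤ #Sel_p} ≥ ζ > 0` and `A < p³ + (p⁴ − p³)ζ`
give a positive lower density of members with `rank E_a(ℚ) = 2` and `Ш(E_a)[p^∞] = 0` (K1, pure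
counting: no parity, no main conjecture, no height, no modularity). [folklore] -/
theorem hasPositiveLowerDensityOn_rank_two_sha_bot_of_cappedAverage_of_tail (p : ℕ) [Fact p.Prime]
    (hGood : Φ.HasDensityOn (fun a ↦ 2 ≤ a.curve.mordellWeilRank ∧
      Nat.card (AddSubgroup.torsionBy a.curve.toAffine.Point (p : ℤ)) = 1) 1)
    {A ζ : ℝ}
    (hA : Φ.AverageOnLE (fun a ↦ min (Nat.card (a.curve.selmerGroup p) : ℝ) ((p : ℝ) ^ 4)) A)
    (hZ : Φ.DensityOnGE (fun a ↦ p ^ 4 ≤ Nat.card (a.curve.selmerGroup p)) ζ) (hζ : 0 < ζ)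
    (hAζ : A < (p : ℝ) ^ 3 + ((p : ℝ) ^ 4 - (p : ℝ) ^ 3) * ζ) :
    Φ.HasPositiveLowerDensityOn (fun a ↦ a.IsMember ∧ a.curve.mordellWeilRank = 2 ∧
      AddCommGroup.primaryComponent a.curve.sha p = ⊥) :=
  hasPositiveLowerDensityOn_rank_two_sha_bot_of_card_selmerGroup_eq_sq Φ p hGood
    (hasPositiveLowerDensityOn_card_selmerGroup_eq_sq_of_cappedAverage_of_tail Φ p hGood hA hZ hζ hAζ)

/-- **I1 and Z give the weak leaf on an explicit large family, FACT-FREE**: if `SelmerThreeAverageLargeF2`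
and the tail density Z hold, then there is a large `Φ ⊆ F₂` with nonempty residue sets (the refined door
family, on which `torsionOrder = 1 ∧ rank ≥ 2` holds member-wise by reduction mod `3·7·13`) in which
the members with `rank E_a(ℚ) = 2 ∧ Ш(E_a)[3^∞] = 0` have positive lower density — no published input
whatsoever (no parity, no modularity, no main conjecture, no `p`-adic height). [folklore] -/
theorem weakLeaf_of_selmerThreeAverage_of_selmerTail (h1 : SelmerThreeAverageLargeF2)
    (hZ : ∀ Φ : CongruenceFamily₂, Φ.IsLarge → (∀ p : ℕ, p.Prime → (Φ.residues p).Nonempty) →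
      ∃ ζ : ℝ, 1 / 6 < ζ ∧ Φ.DensityOnGE (fun a ↦ 81 ≤ Nat.card (a.curve.selmerGroup 3)) ζ) :
    ∃ Φ : CongruenceFamily₂, Φ.IsLarge ∧ (∀ p : ℕ, p.Prime → (Φ.residues p).Nonempty) ∧
      Φ.HasPositiveLowerDensityOn (fun a ↦ a.IsMember ∧ a.curve.mordellWeilRank = 2 ∧
        AddCommGroup.primaryComponent a.curve.sha 3 = ⊥) := by
  obtain ⟨Φ, hL, hne, -, hGen, -⟩ := exists_refinedDoorFamily_densities
  obtain ⟨ζ, hζ6, hT⟩ := hZ Φ hL hne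
  have hGood := hasDensityOn_rank_torsionBy_of_torsionOrder Φ 3 hGen
  have hD9 := hasPositiveLowerDensityOn_selmerNine_of_cappedAverage_of_tail Φ hGood
    (selmerThreeCappedAverage_of_selmerThreeAverageLargeF2 h1 Φ hL) hT (by linarith) (by linarith)
  have hD : Φ.HasPositiveLowerDensityOn (fun a ↦ Nat.card (a.curve.selmerGroup 3) = 3 ^ 2) :=
    hasPositiveLowerDensityOn_mono Φ hD9 fun a h ↦ h.trans (by norm_num)
  exact ⟨Φ, hL, hne, hasPositiveLowerDensityOn_rank_two_sha_bot_of_card_selmerGroup_eq_sq Φ 3 hGood hD⟩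

/-! ### §4 The threshold at a general prime: `1/(p(p−1))`, the same as the root-number door -/

/-- **The tail door's threshold at the Poonen–Rains first moment.** With `A = p²(p+1)` (Poonen–Rains
average of `#Sel_p` for two marked points; `36` at `p = 3`) the door condition `A < p³ + (p⁴ − p³)ζ`
reads `ζ > 1/(p(p−1))` — `1/2, 1/6, 1/20, 1/42` at `p = 2, 3, 5, 7` — the same threshold as the
root-number door's `ρ > 1/(p(p−1))` (pure arithmetic, `1 < p`). [cite: PoonenRains2012, §2 (the model average p^{#marked}·(p+1))] -/
theorem threshold_iff_inv_lt {p ζ : ℝ} (hp : 1 < p) :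
    p ^ 2 * (p + 1) < p ^ 3 + (p ^ 4 - p ^ 3) * ζ ↔ 1 / (p * (p - 1)) < ζ := by
  have hp0 : 0 < p := by linarith
  have hp1 : 0 < p - 1 := by linarith
  have hpp : 0 < p * (p - 1) := mul_pos hp0 hp1
  rw [div_lt_iff₀ hpp]
  constructor
  · intro h
    nlinarith [mul_pos (mul_pos hp0 hp0) hpp]
  · intro h
    nlinarith [mul_pos (mul_pos hp0 hp0) hpp]

end Summit.BirchSwinnertonDyer.BirchSwinnertonDyer.Theorems

end
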